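import Literature.Computability.QuantumComplexity.CircuitEmbedding
import Literature.Computability.Cryptography.QuantumCircuitProofs
import HarnessLib

/-!
# Aaronson–Ambainis Lemma 24 over the sign basis, V: the OR of independent runs

Fifth file of the discharge of `AaronsonAmbainis2018_lemma24_sign_hard` (plan in
`Lemma24Catalysis.lean`): the amplification step of the printed proof (p. 26: "the gap is
amplified") in the form used by the reduction — several independent copies of the given circuit
are run on pairwise disjoint blocks of one register and the event "SOME copy accepts" is read off
(Nielsen–Chuang 2010, §4.5.2; Bernstein–Vazirani 1997, §8: error reduction by repetition). At the
level of ideal (complex) amplitudes this is pure probability over a product distribution, which the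
tree's `CircuitEmbedding.lean` supplies (`prodState`, the frame rule, `sum_normSq_prodState_mul`):

* `acceptWeight U ξ`, `rejectWeight U ξ` — the Born weights of "wire `0` reads `1`/`0`" in `U ξ` for a
  block unitary `U` and block input `ξ` (`acceptWeight + rejectWeight = ‖Uξ‖²`,
  `rejectWeight_eq_one_sub` for unitary `U` and a unit vector);
* **`sum_ite_exists_normSq_prodState`**: for pairwise disjoint blocks `E i` carrying the states `φ i`,
  `Σ_{z : ∃ i, z (E i 0) = 1} |prodState E φ c (z)|² = ∏ᵢ ‖φᵢ‖² − ∏ᵢ rejectWeight(φᵢ)`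
  (`Fintype.prod_sum`); in particular for `a` copies of one unit block state,
  **`sum_ite_exists_normSq_prodState_const`**: `= 1 − (1 − p)^a` with `p` the acceptance weight;
* the threshold arithmetic of the reduction for `a = 4`: `p ≥ 2/3 ⇒ 1 − (1−p)^4 ≥ 80/81`,
  `p ≤ 1/3 ⇒ 1 − (1−p)^4 ≤ 65/81` (`or_amplify_ge`, `or_amplify_le`).

## References

* S. Aaronson, A. Ambainis, *Forrelation*, SIAM J. Comput. 47 (2018), §6, Lemma 24 (p. 26).
* M. A. Nielsen, I. L. Chuang, *Quantum Computation and Quantum Information*, CUP 2010, §2.2.8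
  (composite systems, product distributions), §4.5.2 (repetition).
* E. Bernstein, U. Vazirani, *Quantum complexity theory*, SIAM J. Comput. 26 (1997), §8.
-/

noncomputable section

namespace Literature.Computability.QuantumComplexity

open Matrix _root_.Computability Complexity Cryptography Finset

namespace Lemma24

variable {W b m : ℕ}

/-! ### Acceptance and rejection weights of a block state -/

/-- The Born weight of "wire `0` reads `1`" in the block state `φ` (junk `0` on the empty block).
[cite: NielsenChuang2010, §2.2.5] -/
def acceptWeight (φ : QReg b → ℂ) : ℝ :=
  ∑ v : QReg b, if (∃ h : 0 < b, v ⟨0, h⟩ = true) then ‖φ v‖ ^ 2 else 0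

/-- The Born weight of "wire `0` does not read `1`" in the block state `φ`. [cite: NielsenChuang2010, §2.2.5] -/
def rejectWeight (φ : QReg b → ℂ) : ℝ :=
  ∑ v : QReg b, if (∃ h : 0 < b, v ⟨0, h⟩ = true) then 0 else ‖φ v‖ ^ 2

/-- The two weights exhaust the norm. [cite: NielsenChuang2010, §2.2.5] -/
theorem acceptWeight_add_rejectWeight (φ : QReg b → ℂ) : acceptWeight φ + rejectWeight φ = normSq φ := by
  rw [acceptWeight, rejectWeight, ← Finset.sum_add_distrib, normSq]
  exact Finset.sum_congr rfl fun v _ => by split_ifs <;> simp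

/-- The acceptance weight is nonnegative. [folklore] -/
theorem acceptWeight_nonneg (φ : QReg b → ℂ) : 0 ≤ acceptWeight φ :=
  Finset.sum_nonneg fun v _ => by split_ifs <;> positivity

/-- The rejection weight is nonnegative. [folklore] -/
theorem rejectWeight_nonneg (φ : QReg b → ℂ) : 0 ≤ rejectWeight φ :=
  Finset.sum_nonneg fun v _ => by split_ifs <;> positivity

/-- For a unit block state, `rejectWeight = 1 − acceptWeight`. [cite: NielsenChuang2010, §2.2.5] -/
theorem rejectWeight_eq_one_sub {φ : QReg b → ℂ} (hφ : normSq φ = 1) : rejectWeight φ = 1 - acceptWeight φ := by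
  have := acceptWeight_add_rejectWeight φ; linarith

/-- The acceptance weight of a unit block state is at most `1`. [folklore] -/
theorem acceptWeight_le_one {φ : QReg b → ℂ} (hφ : normSq φ = 1) : acceptWeight φ ≤ 1 := by
  have := acceptWeight_add_rejectWeight φ; have := rejectWeight_nonneg φ; linarith

/-- **The acceptance weight of `U |x 0^m⟩` is the library's acceptance probability** of the circuit
on the classical input `x`. [cite: Yao1993] -/
theorem acceptWeight_eq_acceptProb {G : QGateSet} {n m : ℕ} (A : Language Bool) (C : QCircuit G (n + m)) (x : QReg n) :
    acceptWeight (C.toMatrix A *ᵥ basisState (padInput x m)) = C.acceptProb A x := by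
  rw [acceptWeight, QCircuit.acceptProb]
  refine Finset.sum_congr rfl fun y _ => ?_
  by_cases h : 0 < n + m
  · simp only [h, exists_true_left, dif_pos, QCircuit.runOn]
  · simp only [h, IsEmpty.exists_iff, if_false, dif_neg, not_false_eq_true]

/-! ### The weight of "some block accepts" in a product state -/

/-- **The OR of the block flags in a product state.** For pairwise disjoint blocks,
`Σ_{z : ∃ i, z (Eᵢ 0) = 1} |prodState E φ c (z)|² = ∏ᵢ ‖φᵢ‖² − ∏ᵢ rejectWeight φᵢ`
(inclusion–exclusion on the product distribution of the block contents).
[cite: NielsenChuang2010, §2.2.8] -/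
theorem sum_ite_exists_normSq_prodState {E : Fin m → (Fin b ↪ Fin W)} (hE : BlockDisjoint E)
    (φ : Fin m → QReg b → ℂ) (c : QReg W) :
    (∑ z : QReg W, if (∃ i, ∃ h : 0 < b, z (E i ⟨0, h⟩) = true) then ‖prodState E φ c z‖ ^ 2 else 0) =
      (∏ i, normSq (φ i)) - ∏ i, rejectWeight (φ i) := by
  classical
  -- write the event as a function of the block contents
  have hev : ∀ z : QReg W, (if (∃ i, ∃ h : 0 < b, z (E i ⟨0, h⟩) = true) then ‖prodState E φ c z‖ ^ 2 else 0) =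
      ‖prodState E φ c z‖ ^ 2 * (if (∃ i, ∃ h : 0 < b, (z ∘ E i) ⟨0, h⟩ = true) then (1 : ℝ) else 0) := by
    intro z
    simp only [Function.comp_apply]
    split_ifs <;> simp
  simp_rw [hev]
  rw [sum_normSq_prodState_mul hE φ c (fun y => if (∃ i, ∃ h : 0 < b, y i ⟨0, h⟩ = true) then (1 : ℝ) else 0)]
  -- inclusion–exclusion: `[∃] = 1 − [∀ ¬]`
  have hsplit : ∀ y : Fin m → QReg b,
      (∏ i, ‖φ i (y i)‖ ^ 2) * (if (∃ i, ∃ h : 0 < b, y i ⟨0, h⟩ = true) then (1 : ℝ) else 0) =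
        (∏ i, ‖φ i (y i)‖ ^ 2) - ∏ i, (if (∃ h : 0 < b, y i ⟨0, h⟩ = true) then 0 else ‖φ i (y i)‖ ^ 2) := by
    intro y
    by_cases hex : ∃ i, ∃ h : 0 < b, y i ⟨0, h⟩ = true
    · rw [if_pos hex, mul_one]
      obtain ⟨i, hi⟩ := hex
      have hz : (∏ i, (if (∃ h : 0 < b, y i ⟨0, h⟩ = true) then (0 : ℝ) else ‖φ i (y i)‖ ^ 2)) = 0 :=
        Finset.prod_eq_zero (Finset.mem_univ i) (by rw [if_pos hi])
      rw [hz, sub_zero]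
    · rw [if_neg hex, mul_zero, eq_comm, sub_eq_zero]
      refine Finset.prod_congr rfl fun i _ => ?_
      rw [if_neg (fun h => hex ⟨i, h⟩)]
  simp_rw [hsplit]
  rw [Finset.sum_sub_distrib]
  congr 1
  · simp only [normSq]
    exact (Fintype.prod_sum (fun i (v : QReg b) => ‖φ i v‖ ^ 2)).symm
  · simp only [rejectWeight]
    exact (Fintype.prod_sum (fun i (v : QReg b) => if (∃ h : 0 < b, v ⟨0, h⟩ = true) then (0 : ℝ) else ‖φ i v‖ ^ 2)).symm

/-- **`a` independent copies of one unit block state**: the weight of "some copy accepts" is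
`1 − (1 − p)^a`, `p` the acceptance weight of the block state. [cite: NielsenChuang2010, §4.5.2] -/
theorem sum_ite_exists_normSq_prodState_const {E : Fin m → (Fin b ↪ Fin W)} (hE : BlockDisjoint E)
    {φ : QReg b → ℂ} (hφ : normSq φ = 1) (c : QReg W) :
    (∑ z : QReg W, if (∃ i, ∃ h : 0 < b, z (E i ⟨0, h⟩) = true) then ‖prodState E (fun _ => φ) c z‖ ^ 2 else 0) =
      1 - (1 - acceptWeight φ) ^ m := by
  rw [sum_ite_exists_normSq_prodState hE (fun _ => φ) c]
  simp [hφ, rejectWeight_eq_one_sub hφ]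

/-! ### Threshold arithmetic for four copies -/

/-- `p ≥ 2/3 ⇒ 1 − (1 − p)^4 ≥ 80/81` (and `≤ 1`). [cite: AaronsonAmbainis2018, §6 Lemma 24 (p. 26, amplification)] -/
theorem or_amplify_ge {p : ℝ} (hp : 2 / 3 ≤ p) (hp1 : p ≤ 1) : (80 : ℝ) / 81 ≤ 1 - (1 - p) ^ 4 := by
  have h0 : 0 ≤ 1 - p := by linarith
  have h1 : 1 - p ≤ 1 / 3 := by linarith
  have h4 : (1 - p) ^ 4 ≤ (1 / 3) ^ 4 := pow_le_pow_left₀ h0 h1 4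
  linarith [h4]

/-- `p ≤ 1/3 ⇒ 1 − (1 − p)^4 ≤ 65/81`. [cite: AaronsonAmbainis2018, §6 Lemma 24 (p. 26, amplification)] -/
theorem or_amplify_le {p : ℝ} (hp : p ≤ 1 / 3) : 1 - (1 - p) ^ 4 ≤ (65 : ℝ) / 81 := by
  have h0 : (2 : ℝ) / 3 ≤ 1 - p := by linarith
  have h4 : ((2 : ℝ) / 3) ^ 4 ≤ (1 - p) ^ 4 := pow_le_pow_left₀ (by norm_num) h0 4
  linarith [h4]

/-- The OR-weight lies in `[0, 1]`: lower bound. [folklore] -/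
theorem or_amplify_nonneg {p : ℝ} (hp0 : 0 ≤ p) (hp1 : p ≤ 1) (a : ℕ) : 0 ≤ 1 - (1 - p) ^ a := by
  have : (1 - p) ^ a ≤ 1 := pow_le_one₀ (by linarith) (by linarith)
  linarith

/-- The OR-weight lies in `[0, 1]`: upper bound. [folklore] -/
theorem or_amplify_le_one {p : ℝ} (hp1 : p ≤ 1) (a : ℕ) : 1 - (1 - p) ^ a ≤ 1 := by
  have : 0 ≤ (1 - p) ^ a := pow_nonneg (by linarith) a
  linarith

end Lemma24

end Literature.Computability.QuantumComplexity

end
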